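import Mathlib
import Summits.NavierStokesRegularity.NavierStokesRegularity.Theorems.EulerZoomLiouvillePowerGaugeEulerLiouvilleSelfSimilarPastStrata
import Summits.NavierStokesRegularity.NavierStokesRegularity.Theorems.EulerZoomLiouvillePowerGaugeEulerLiouvilleSelfSimilarBernoulliPiercing
import Summits.NavierStokesRegularity.NavierStokesRegularity.Theorems.EulerZoomLiouvillePowerGaugeEulerLiouvilleSelfSimilarPastSubExtremal
import Summits.NavierStokesRegularity.NavierStokesRegularity.Theorems.EulerZoomLiouvillePowerGaugeEulerLiouvilleSelfSimilarPressureSlavingPast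
import HarnessLib

/-!
# Crux E `PowerGaugeEulerLiouville` (stmt-NavierStokesRegularity-19832): the PAST-EXACT strata need the VELOCITY clause only
# (lane «pressure slaving», file 2 consumers; LEAD ns-typeII-p2 g11 v57 queue «past/shifted strata velocity-only»; width seat ns-ezl-w3 g2)

Route `EulerZoomLiouville` (NavierStokesRegularity), crux E.  The past-exact `C²` fillers of `…SelfSimilarPastStrata` / `…SelfSimilarBernoulliPiercing` (LEAD lineage) carry the
pressure clause `∀ τ < T₁, p τ = fun x => selfSimilarCollapsePressure (1/(2+ρ)) T P τ (x − x₀)`.  By the past form of pressure slaving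
(`PressureSlaving.inClass_pastSelfSimilarPressure`, `…SelfSimilarPressureSlavingPast`) a member whose VELOCITY is exactly self-similar about `(T, x₀)` on the
window `τ < T₁` has an in-class pressure `p'` (same `u`, `H`, `c`) satisfying exactly that clause for a slaved profile `Q` — so the clause can be dropped:

* `Past.selfSimilar_ae_eq_zero_of_irrotationalC2_profile_velocity`,
* `Past.selfSimilar_ae_eq_zero_of_radialInflowC2_profile_velocity`,
* `Past.selfSimilar_ae_eq_zero_of_uniformContinuousC2_profile_velocity`,
* `Past.selfSimilar_ae_eq_zero_of_compactCurlC2_profile_velocity`,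
* `Past.selfSimilar_ae_eq_zero_of_piercingBernoulliC2_profile_past_velocity` (LEAD g11's Bernoulli-piercing past filler, p624179),
* WEAK class (no `C²`): `Past.selfSimilar_ae_eq_zero_of_subExtremal_past_velocity`, `Past.selfSimilar_ae_eq_zero_of_finiteEnergy_profile_past_velocity`
  (ns-ezl-w1's Bronzi–Shvydkoy dichotomy on past windows, `…SelfSimilarPastSubExtremal`)
— crux hypotheses verbatim (`0 < ρ ≤ ½`) + `∀ τ < T₁, u τ = fun x => selfSimilarCollapse (1/(2+ρ)) T V τ (x − x₀)` (`T₁ ≤ 0`, `T₁ ≤ T`) + the respective tameness / smallness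
of the profile `V` ⇒ `u = 0` a.e. on the slab; NO hypothesis on the pressure (for the weak strata this is the point: a weak member has no classical pressure to write down).

WHAT THIS IS NOT: not NS regularity, not the crux E — seven strata of the crux CLASS 19832 on the MODEL lattice with one hypothesis fewer; `--supports` stmt-19832.
[folklore]
-/

noncomputable section

-- flat `Theorems/<Route><Decl>…` files of one crux share the namespace of the crux (tree convention: `Summit.<S>.<S>.…`)
set_option linter.dupNamespace false

open MeasureTheory Set Filter Topology Metric Function TopologicalSpace
open scoped ENNReal NNReal RealInnerProductSpace

namespace Summit.NavierStokesRegularity.NavierStokesRegularity.Theorems.PowerGaugeEulerLiouville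

open Literature.Analysis Literature.Analysis.FunctionSpaces Literature.Analysis.FluidPDE

namespace Past

variable {ρ T T₁ : ℝ}
  {u : ℝ → EuclideanSpace ℝ (Fin 3) → EuclideanSpace ℝ (Fin 3)} {p : ℝ → EuclideanSpace ℝ (Fin 3) → ℝ}
  {H : ℝ → EuclideanSpace ℝ (Fin 3) → EuclideanSpace ℝ (Fin 3) →L[ℝ] EuclideanSpace ℝ (Fin 3)} {c : ℝ≥0}
  {V : EuclideanSpace ℝ (Fin 3) → EuclideanSpace ℝ (Fin 3)}

/-- **PAST-EXACT VELOCITY WITH IRROTATIONAL `C²` PROFILE ⇒ TRIVIAL** (no pressure clause). [folklore] -/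
theorem selfSimilar_ae_eq_zero_of_irrotationalC2_profile_velocity (hρ : 0 < ρ) (hρh : ρ ≤ 1 / 2) (hT₁ : T₁ ≤ 0) (hTT₁ : T₁ ≤ T)
    (x₀ : EuclideanSpace ℝ (Fin 3))
    (hsw : IsSuitableWeakSolutionOn (slab (EuclideanSpace ℝ (Fin 3)) (Iio 0) isOpen_Iio) 0 0 u p)
    (hH : HasWeakSpatialGradientOn (slab (EuclideanSpace ℝ (Fin 3)) (Iio 0) isOpen_Iio) u H)
    (hgauge : ∀ a : ℝ, 0 < a →
      ENNReal.ofReal (a ^ (2 * ρ)) * cknA a (0 : ℝ × EuclideanSpace ℝ (Fin 3)) u +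
          ENNReal.ofReal (a ^ ρ) * cknE a (0 : ℝ × EuclideanSpace ℝ (Fin 3)) H +
        ENNReal.ofReal (a ^ (2 * ρ)) * cknD a (0 : ℝ × EuclideanSpace ℝ (Fin 3)) p ≤ (c : ℝ≥0∞))
    (hu : ∀ τ : ℝ, τ < T₁ → u τ = fun x => selfSimilarCollapse (1 / (2 + ρ)) T V τ (x - x₀))
    (hV : ContDiff ℝ 2 V) (hcurl : ∀ x, curl V x = 0) :
    uncurry u =ᵐ[volume.restrict (Iio (0 : ℝ) ×ˢ (univ : Set (EuclideanSpace ℝ (Fin 3))))] 0 := by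
  obtain ⟨Q, p', -, hp', -, hsw', -, hgauge'⟩ :=
    PressureSlaving.inClass_pastSelfSimilarPressure (g := 1 / (2 + ρ)) (by linarith) hT₁ hTT₁ ⟨hsw, hH, hgauge⟩ hu
  exact selfSimilar_ae_eq_zero_of_irrotationalC2_profile hρ hρh hT₁ hTT₁ x₀ hsw' hH hgauge' hu hp' hV hcurl

/-- **PAST-EXACT VELOCITY, `C²` PROFILE WITHOUT FAST RADIAL INFLOW ⇒ TRIVIAL** (no pressure clause). [folklore] -/
theorem selfSimilar_ae_eq_zero_of_radialInflowC2_profile_velocity (hρ : 0 < ρ) (hρh : ρ ≤ 1 / 2) (hT₁ : T₁ ≤ 0) (hTT₁ : T₁ ≤ T)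
    (x₀ : EuclideanSpace ℝ (Fin 3))
    (hsw : IsSuitableWeakSolutionOn (slab (EuclideanSpace ℝ (Fin 3)) (Iio 0) isOpen_Iio) 0 0 u p)
    (hH : HasWeakSpatialGradientOn (slab (EuclideanSpace ℝ (Fin 3)) (Iio 0) isOpen_Iio) u H)
    (hgauge : ∀ a : ℝ, 0 < a →
      ENNReal.ofReal (a ^ (2 * ρ)) * cknA a (0 : ℝ × EuclideanSpace ℝ (Fin 3)) u +
          ENNReal.ofReal (a ^ ρ) * cknE a (0 : ℝ × EuclideanSpace ℝ (Fin 3)) H +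
        ENNReal.ofReal (a ^ (2 * ρ)) * cknD a (0 : ℝ × EuclideanSpace ℝ (Fin 3)) p ≤ (c : ℝ≥0∞))
    (hu : ∀ τ : ℝ, τ < T₁ → u τ = fun x => selfSimilarCollapse (1 / (2 + ρ)) T V τ (x - x₀))
    (hV : ContDiff ℝ 2 V) {κ R₁ : ℝ} (hκ : κ < 1 / (2 + ρ))
    (hR₁ : ∀ y : EuclideanSpace ℝ (Fin 3), R₁ ≤ ‖y‖ → -(κ * ‖y‖ ^ 2) ≤ ⟪y, V y⟫) :
    uncurry u =ᵐ[volume.restrict (Iio (0 : ℝ) ×ˢ (univ : Set (EuclideanSpace ℝ (Fin 3))))] 0 := by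
  obtain ⟨Q, p', -, hp', -, hsw', -, hgauge'⟩ :=
    PressureSlaving.inClass_pastSelfSimilarPressure (g := 1 / (2 + ρ)) (by linarith) hT₁ hTT₁ ⟨hsw, hH, hgauge⟩ hu
  exact selfSimilar_ae_eq_zero_of_radialInflowC2_profile hρ hρh hT₁ hTT₁ x₀ hsw' hH hgauge' hu hp' hV hκ hR₁

/-- **PAST-EXACT VELOCITY WITH UNIFORMLY CONTINUOUS `C²` PROFILE ⇒ TRIVIAL** (no pressure clause). [folklore] -/
theorem selfSimilar_ae_eq_zero_of_uniformContinuousC2_profile_velocity (hρ : 0 < ρ) (hρh : ρ ≤ 1 / 2) (hT₁ : T₁ ≤ 0)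
    (hTT₁ : T₁ ≤ T) (x₀ : EuclideanSpace ℝ (Fin 3))
    (hsw : IsSuitableWeakSolutionOn (slab (EuclideanSpace ℝ (Fin 3)) (Iio 0) isOpen_Iio) 0 0 u p)
    (hH : HasWeakSpatialGradientOn (slab (EuclideanSpace ℝ (Fin 3)) (Iio 0) isOpen_Iio) u H)
    (hgauge : ∀ a : ℝ, 0 < a →
      ENNReal.ofReal (a ^ (2 * ρ)) * cknA a (0 : ℝ × EuclideanSpace ℝ (Fin 3)) u +
          ENNReal.ofReal (a ^ ρ) * cknE a (0 : ℝ × EuclideanSpace ℝ (Fin 3)) H +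
        ENNReal.ofReal (a ^ (2 * ρ)) * cknD a (0 : ℝ × EuclideanSpace ℝ (Fin 3)) p ≤ (c : ℝ≥0∞))
    (hu : ∀ τ : ℝ, τ < T₁ → u τ = fun x => selfSimilarCollapse (1 / (2 + ρ)) T V τ (x - x₀))
    (hV : ContDiff ℝ 2 V) (hUC : UniformContinuous V) :
    uncurry u =ᵐ[volume.restrict (Iio (0 : ℝ) ×ˢ (univ : Set (EuclideanSpace ℝ (Fin 3))))] 0 := by
  obtain ⟨Q, p', -, hp', -, hsw', -, hgauge'⟩ :=
    PressureSlaving.inClass_pastSelfSimilarPressure (g := 1 / (2 + ρ)) (by linarith) hT₁ hTT₁ ⟨hsw, hH, hgauge⟩ hu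
  exact selfSimilar_ae_eq_zero_of_uniformContinuousC2_profile hρ hρh hT₁ hTT₁ x₀ hsw' hH hgauge' hu hp' hV hUC

/-- **PAST-EXACT VELOCITY, `C²` PROFILE WITH COMPACTLY SUPPORTED VORTICITY ⇒ TRIVIAL** (no pressure clause). [folklore] -/
theorem selfSimilar_ae_eq_zero_of_compactCurlC2_profile_velocity (hρ : 0 < ρ) (hρh : ρ ≤ 1 / 2) (hT₁ : T₁ ≤ 0) (hTT₁ : T₁ ≤ T)
    (x₀ : EuclideanSpace ℝ (Fin 3))
    (hsw : IsSuitableWeakSolutionOn (slab (EuclideanSpace ℝ (Fin 3)) (Iio 0) isOpen_Iio) 0 0 u p)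
    (hH : HasWeakSpatialGradientOn (slab (EuclideanSpace ℝ (Fin 3)) (Iio 0) isOpen_Iio) u H)
    (hgauge : ∀ a : ℝ, 0 < a →
      ENNReal.ofReal (a ^ (2 * ρ)) * cknA a (0 : ℝ × EuclideanSpace ℝ (Fin 3)) u +
          ENNReal.ofReal (a ^ ρ) * cknE a (0 : ℝ × EuclideanSpace ℝ (Fin 3)) H +
        ENNReal.ofReal (a ^ (2 * ρ)) * cknD a (0 : ℝ × EuclideanSpace ℝ (Fin 3)) p ≤ (c : ℝ≥0∞))
    (hu : ∀ τ : ℝ, τ < T₁ → u τ = fun x => selfSimilarCollapse (1 / (2 + ρ)) T V τ (x - x₀))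
    (hV : ContDiff ℝ 2 V) (hΩc : HasCompactSupport (curl V)) :
    uncurry u =ᵐ[volume.restrict (Iio (0 : ℝ) ×ˢ (univ : Set (EuclideanSpace ℝ (Fin 3))))] 0 := by
  obtain ⟨Q, p', -, hp', -, hsw', -, hgauge'⟩ :=
    PressureSlaving.inClass_pastSelfSimilarPressure (g := 1 / (2 + ρ)) (by linarith) hT₁ hTT₁ ⟨hsw, hH, hgauge⟩ hu
  exact selfSimilar_ae_eq_zero_of_compactCurlC2_profile hρ hρh hT₁ hTT₁ x₀ hsw' hH hgauge' hu hp' hV hΩc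

/-- **PAST-EXACT VELOCITY, `C²` PROFILE WITH BERNOULLI PIERCING ON SPHERES BEYOND EVERY RADIUS ⇒ TRIVIAL** (LEAD g11's v48 past filler, no pressure clause).
[folklore] -/
theorem selfSimilar_ae_eq_zero_of_piercingBernoulliC2_profile_past_velocity (hρ : 0 < ρ) (hρh : ρ ≤ 1 / 2) (hT₁ : T₁ ≤ 0)
    (hTT₁ : T₁ ≤ T) (x₀ : EuclideanSpace ℝ (Fin 3))
    (hsw : IsSuitableWeakSolutionOn (slab (EuclideanSpace ℝ (Fin 3)) (Iio 0) isOpen_Iio) 0 0 u p)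
    (hH : HasWeakSpatialGradientOn (slab (EuclideanSpace ℝ (Fin 3)) (Iio 0) isOpen_Iio) u H)
    (hgauge : ∀ a : ℝ, 0 < a →
      ENNReal.ofReal (a ^ (2 * ρ)) * cknA a (0 : ℝ × EuclideanSpace ℝ (Fin 3)) u +
          ENNReal.ofReal (a ^ ρ) * cknE a (0 : ℝ × EuclideanSpace ℝ (Fin 3)) H +
        ENNReal.ofReal (a ^ (2 * ρ)) * cknD a (0 : ℝ × EuclideanSpace ℝ (Fin 3)) p ≤ (c : ℝ≥0∞))
    (hu : ∀ τ : ℝ, τ < T₁ → u τ = fun x => selfSimilarCollapse (1 / (2 + ρ)) T V τ (x - x₀))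
    (hV : ContDiff ℝ 2 V)
    (hS : ∀ P' : EuclideanSpace ℝ (Fin 3) → ℝ, IsSelfSimilarEulerProfile (1 / (2 + ρ)) 0 V P' →
      ∀ h R₀ : ℝ, ∃ R : ℝ, R₀ ≤ R ∧ ∀ y : EuclideanSpace ℝ (Fin 3), ‖y‖ = R →
        ⟪y, V y⟫ ≤ -(1 / (2 + ρ) * ‖y‖ ^ 2) →
          (curl V y = 0 ∨ selfSimilarBernoulli (1 / (2 + ρ)) 0 V P' y < h)) :
    uncurry u =ᵐ[volume.restrict (Iio (0 : ℝ) ×ˢ (univ : Set (EuclideanSpace ℝ (Fin 3))))] 0 := by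
  obtain ⟨Q, p', -, hp', -, hsw', -, hgauge'⟩ :=
    PressureSlaving.inClass_pastSelfSimilarPressure (g := 1 / (2 + ρ)) (by linarith) hT₁ hTT₁ ⟨hsw, hH, hgauge⟩ hu
  exact selfSimilar_ae_eq_zero_of_piercingBernoulliC2_profile_past hρ hρh hT₁ hTT₁ x₀ hsw' hH hgauge' hu hp' hV hS

/-- **PAST-EXACT VELOCITY (WEAK CLASS) WITH SUB-EXTREMAL PROFILE ⇒ TRIVIAL** (no pressure clause, no regularity of the profile):
`liminf_L L^{2ρ−1}∫_{B_L}|V|² = 0` ⇒ `u = 0` a.e. [folklore; cf. BronziShvydkoy2015 Thm 1.1] -/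
theorem selfSimilar_ae_eq_zero_of_subExtremal_past_velocity (hρ : 0 < ρ) (hρh : ρ ≤ 1 / 2) (hT₁ : T₁ ≤ 0) (hTT₁ : T₁ ≤ T)
    (x₀ : EuclideanSpace ℝ (Fin 3))
    (hsw : IsSuitableWeakSolutionOn (slab (EuclideanSpace ℝ (Fin 3)) (Iio 0) isOpen_Iio) 0 0 u p)
    (hH : HasWeakSpatialGradientOn (slab (EuclideanSpace ℝ (Fin 3)) (Iio 0) isOpen_Iio) u H)
    (hgauge : ∀ a : ℝ, 0 < a →
      ENNReal.ofReal (a ^ (2 * ρ)) * cknA a (0 : ℝ × EuclideanSpace ℝ (Fin 3)) u +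
          ENNReal.ofReal (a ^ ρ) * cknE a (0 : ℝ × EuclideanSpace ℝ (Fin 3)) H +
        ENNReal.ofReal (a ^ (2 * ρ)) * cknD a (0 : ℝ × EuclideanSpace ℝ (Fin 3)) p ≤ (c : ℝ≥0∞))
    (hu : ∀ τ : ℝ, τ < T₁ → u τ = fun x => selfSimilarCollapse (1 / (2 + ρ)) T V τ (x - x₀))
    (hsub : ∀ ε : ℝ, 0 < ε → ∀ L₀ : ℝ, ∃ L : ℝ, L₀ ≤ L ∧
      L ^ (2 * ρ - 1) * ∫ y in ball (0 : EuclideanSpace ℝ (Fin 3)) L, ‖V y‖ ^ 2 < ε) :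
    uncurry u =ᵐ[volume.restrict (Iio (0 : ℝ) ×ˢ (univ : Set (EuclideanSpace ℝ (Fin 3))))] 0 := by
  obtain ⟨Q, p', -, hp', -, hsw', -, hgauge'⟩ :=
    PressureSlaving.inClass_pastSelfSimilarPressure (g := 1 / (2 + ρ)) (by linarith) hT₁ hTT₁ ⟨hsw, hH, hgauge⟩ hu
  exact selfSimilar_ae_eq_zero_of_subExtremal_past hρ hρh hT₁ hTT₁ x₀ hsw' hH hgauge' hu hp' hsub

/-- **PAST-EXACT VELOCITY (WEAK CLASS) WITH FINITE-ENERGY PROFILE ⇒ TRIVIAL** (`0 < ρ < ½`; no pressure clause). [folklore; cf. BronziShvydkoy2015 Thm 1.1] -/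
theorem selfSimilar_ae_eq_zero_of_finiteEnergy_profile_past_velocity (hρ : 0 < ρ) (hρh : ρ < 1 / 2) (hT₁ : T₁ ≤ 0)
    (hTT₁ : T₁ ≤ T) (x₀ : EuclideanSpace ℝ (Fin 3))
    (hsw : IsSuitableWeakSolutionOn (slab (EuclideanSpace ℝ (Fin 3)) (Iio 0) isOpen_Iio) 0 0 u p)
    (hH : HasWeakSpatialGradientOn (slab (EuclideanSpace ℝ (Fin 3)) (Iio 0) isOpen_Iio) u H)
    (hgauge : ∀ a : ℝ, 0 < a →
      ENNReal.ofReal (a ^ (2 * ρ)) * cknA a (0 : ℝ × EuclideanSpace ℝ (Fin 3)) u +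
          ENNReal.ofReal (a ^ ρ) * cknE a (0 : ℝ × EuclideanSpace ℝ (Fin 3)) H +
        ENNReal.ofReal (a ^ (2 * ρ)) * cknD a (0 : ℝ × EuclideanSpace ℝ (Fin 3)) p ≤ (c : ℝ≥0∞))
    (hu : ∀ τ : ℝ, τ < T₁ → u τ = fun x => selfSimilarCollapse (1 / (2 + ρ)) T V τ (x - x₀))
    (hfin : Integrable (fun y => ‖V y‖ ^ 2) volume) :
    uncurry u =ᵐ[volume.restrict (Iio (0 : ℝ) ×ˢ (univ : Set (EuclideanSpace ℝ (Fin 3))))] 0 := by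
  obtain ⟨Q, p', -, hp', -, hsw', -, hgauge'⟩ :=
    PressureSlaving.inClass_pastSelfSimilarPressure (g := 1 / (2 + ρ)) (by linarith) hT₁ hTT₁ ⟨hsw, hH, hgauge⟩ hu
  exact selfSimilar_ae_eq_zero_of_finiteEnergy_profile_past hρ hρh hT₁ hTT₁ x₀ hsw' hH hgauge' hu hp' hfin

end Past

end Summit.NavierStokesRegularity.NavierStokesRegularity.Theorems.PowerGaugeEulerLiouville

end
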